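import Summits.BirchSwinnertonDyer.BirchSwinnertonDyer.Theorems.ByReductionTypeAtTwoSupersingularFlatRoadLineV9
import Summits.BirchSwinnertonDyer.BirchSwinnertonDyer.Theorems.ByReductionTypeAtTwoSupersingularFlatCountTwoAll
import Summits.BirchSwinnertonDyer.BirchSwinnertonDyer.Theorems.ByReductionTypeAtTwoSupersingularH1IwPointsModelFreeOfGreenberg1989
import Summits.BirchSwinnertonDyer.BirchSwinnertonDyer.Theorems.ByReductionTypeAtTwoSupersingularFlatLocalDataOfHondaSystem
import HarnessLib

/-!
# COUNT♭@2 BY NAME for line `odd_blind_package`: the `hcount` binder of `SSFlatRoad.flatEulerChar_two`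
# IS A TREE THEOREM (door v11 `SSFlatEC.flatCountTwo_all`), and EC♭@2 with the count DISCHARGED

Seat `bsd-2adic-t42` GEN 47 (hand H2-COUNT, pen SUMMON 20260831T160614Z, director-bsd (844)(d)), crux
`SupersingularRankZeroAtTwo` (item stmt-BirchSwinnertonDyer-19097, route `ByReductionTypeAtTwo`, rung K4), line
`odd_blind_package` (registry v2.14, `Cruxes/SupersingularRankZeroAtTwo/Lines/odd_blind_package.lean`; stub 2
`UniformFlatHondaDataAtTwo`, conjunct (7) = COUNT♭ :1646–1657; v2.16 `FlatPackageAtTwo`, same conjunct token-equal).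

WHAT. The layer-`0` ♭ control count at `2` (Greenberg LNM 1716 Lemma 4.7 «`|ker g| · |E(F)_p| = |ker r| · |(Sel_∞)_Γ|`»
composed with Lemma 4.4's kernel count, for Sprung's `Sel♭(E/ℚ_∞)` at `p = 2`):
`#(A♭_0/Sel_0) · #E[2^∞]^{Γ_ℚ} = 2^{ord₂ ∏ c_ℓ} · #(Sel♭_∞)_γ` GIVEN `Sel_{2^∞}(E/ℚ)` and `(Sel♭_∞)_γ` finite — the
`hcount` hypothesis of the tree's EC♭@2 `SSFlatRoad.flatEulerChar_two` (`…FlatRoadLineV9`, seat ss-1 GEN 10) — is, TOKEN FOR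
TOKEN, the conclusion of the tree theorem `SSFlatEC.flatCountTwo_all` (`…FlatCountTwoAll`, door v11 of the sibling line
`flat_uniform_two`, seat `prover-bsd-wall-tp2-p3-w3`, 2026-08-28: the Honda₂ clauses `hg hc hTr hinj hsat` + `GoodSS W 2` +
`κ` cyclotomic with topological generator `γ` + `v ∣ 2`; NO named fact — the four generic Poitou–Tate rows over `ℚ`
(Milne *ADT* I Thm. 4.10 (a)(b)(c)₃, Cor. 4.16) and Cassels' surjectivity are tree theorems, Greenberg's p. 108 local
surjectivity is `Greenberg1999.localQuotient_restriction_surjective_holds`, `r₂` injective for ♭ is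
`Sprung2024.lem55AllN_…`, the Tamagawa kernels at `ℓ ≠ 2` and `E(ℚ_∞)[2^∞] = 0` (Lemma 2.3 at `2`) are tree theorems).
The cyclotomicity binder `hκ` of `flatCountTwo_all` is discharged by the tree theorem `LocalIwH1.isCyclotomic_of_rat`
(every `ℤ_p`-extension of `ℚ` is the cyclotomic one, Kronecker–Weber in the kernel; `…H1IwPointsModelFreeOfGreenberg1989`,
seat tower-1 GEN 65), so the binders below are EXACTLY those of `flatEulerChar_two`.  This file records the identification
under the names the line's kernel uses:

* `SSFlatRoad.flatCount_two` — the binders of `flatEulerChar_two` up to `hsat` and nothing else, conclusion = the `hcount`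
  binder VERBATIM = registry v2.14 :1646–1657; proof `SSFlatEC.flatCountTwo_all` ∘ `LocalIwH1.isCyclotomic_of_rat`.
* `SSFlatRoad.flatCount_two_of_isHondaSystemAtTwo` — the same keyed on the v2.16 `FlatPackageAtTwo` prefix `(hg) (hH : IsHondaSystemAtTwo
  κ ι W a₂ g cneg c)` (the Honda₂ clauses extracted from the Honda system, (INJ)/(SAT) transported along the odd `a₂² − 2a₂ − 1`).
* `SSFlatRoad.flatEulerChar_two_of_honda` — EC♭@2 (`f(0) = u · 2^{ord₂ ∏ c_ℓ} · #Sel_{2^∞}(E/ℚ)` for every ♭ dual datum with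
  `X♭` finitely generated torsion and `char X♭ = (f)`) with the COUNT DISCHARGED: the binders of `flatEulerChar_two` with
  `hcount` DELETED (the Honda₂ clauses alone carry it).

By-name recipe for the line's kernel (registry :1879–1890): `hcount := SSFlatRoad.flatCount_two W hss κ hγ hv hg hc hTr hinj hsat`,
or feed (K) by `SSFlatRoad.flatEulerChar_two_of_honda W hss κ hγ hv hg hc hTr hinj hsat D hX f hf hfin` and drop conjunct (7)
of stub 2 at the next registry touch (the LEAD's call, on the director's word).

HONEST FRAMING: theorems only (no definition, no named fact, no instance, no `sorry`); a helper
(`--supports stmt-BirchSwinnertonDyer-19097`). «COUNT♭ holds in the kernel for every `(W, κ, γ, v, g, c)` satisfying the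
Honda₂ clauses» closes NO stub by itself (`stub_flatPackage` keeps F1♭ ∧ F3); 19097 stays OPEN; nothing is booked
(D-0054); typed ≠ proved; BSD is proved for no curve by any of this.  bears_on: K4 (19097).

References: [GreenbergLNM1716] §4 Lemmas 4.3, 4.4, 4.7 (pp. 103–108), Prop. 4.13 (p. 122); [Sprung2024] §5.2 Lemmas
5.5–5.9 and Proof of Thm. 5.3 (pp. 39–41); [Sprung2012] Lemma 2.3, Thm. 2.2 (2′) (p. 1487), Def. 7.9–7.11 (p. 1503);
[MilneADT2006] I Thm. 4.10, Cor. 4.16; [BDKim2013] proof of Cor. 3.15 (pp. 199–200) (the `±` twin);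
[Washington1997] §13.1 (p. 264), Thm. 14.1.
-/

set_option autoImplicit false
-- the Theorems namespace of this sub repeats the summit name by design (D-0017 nested layout)
set_option linter.dupNamespace false

noncomputable section

open scoped Classical MatrixGroups ModularForm NumberField
open NumberField IsDedekindDomain CongruenceSubgroup WeierstrassCurve Literature.NumberTheory.EllipticCurves
  Literature.NumberTheory.EllipticCurves.ModularForms Literature.NumberTheory.EllipticCurves.Sprung2017
  Literature.NumberTheory.EllipticCurves.Sprung2012
  Literature.NumberTheory.EllipticCurves.Rank1Residual Literature.NumberTheory.EllipticCurves.Rank1Residual.Typed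
  Literature.NumberTheory.EllipticCurves.Kobayashi2003 Literature.NumberTheory.EllipticCurves.IwasawaDual
  Literature.NumberTheory.GaloisRepresentations
  ZpExtension Summit.BirchSwinnertonDyer.Rank1Residual Summit.BirchSwinnertonDyer.Rank1Residual.Supersingular
  Summit.BirchSwinnertonDyer.Rank1Residual.X5.O1

namespace Summit.BirchSwinnertonDyer.BirchSwinnertonDyer.Theorems
namespace SSFlatRoad

/-- **COUNT♭@2 — the layer-`0` ♭ control count at `2`, BY NAME.** For `W/ℚ` elliptic, globally minimal, good
supersingular at `2`; a `ℤ₂`-extension `κ` of `ℚ` (necessarily the cyclotomic one, `LocalIwH1.isCyclotomic_of_rat`) with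
topological generator `γ`; the place `v ∋ 2`; a local `g`
restricting to a generator; local points `c` with the Honda₂ clauses (levels, `n ≥ 1` trace relation with `a₂`,
level-`0` injectivity and `2`-saturation ON `c_0`): IF `Sel_{2^∞}(E/ℚ)` is finite and the `γ`-coinvariants
`(Sel♭_∞)_γ` are finite THEN `#(A♭_0/Sel_0) · #E[2^∞]^{Γ_ℚ} = 2^{ord₂ ∏ c_ℓ} · #(Sel♭_∞)_γ`
(`A♭_0 = h_0⁻¹(Sel♭_∞)`, `h_0 : H¹(ℚ, E[2^∞]) → H¹(ℚ_∞, E[2^∞])`; Greenberg's Lemma 4.7 with Lemma 4.4 for `Sel♭` at `2`).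
The conclusion is the `hcount` binder of `flatEulerChar_two` VERBATIM (= registry v2.14 :1646–1657 of line
`odd_blind_package`); the binders are EXACTLY those of `flatEulerChar_two` up to `hsat`; the proof is the tree theorem
`SSFlatEC.flatCountTwo_all` (door v11, no named fact) at `LocalIwH1.isCyclotomic_of_rat κ`.
[cite: GreenbergLNM1716, §4 Lemma 4.3 (p. 103), Lemma 4.4 (p. 104), Lemma 4.7 (pp. 107–108), Prop. 4.13 (p. 122)]
[cite: Sprung2024, §5.2 Lemma 5.5 and Proof of Thm. 5.3 (pp. 39–41)] [cite: Sprung2012, Lemma 2.3 (p. 1487), Def. 7.9–7.11 (p. 1503)]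
[cite: MilneADT2006, Ch. I, Thm. 4.10 and Cor. 4.16] [cite: Washington1997, §13.1 (p. 264) and Thm. 14.1] -/
theorem flatCount_two (W : WeierstrassCurve ℚ) [W.IsElliptic] [W.IsGloballyMinimal] (hss : GoodSS W 2)
    (κ : ZpExtension ℚ 2) {γ : Field.absoluteGaloisGroup ℚ} (hγ : κ.IsTopGenerator γ)
    {v : HeightOneSpectrum (𝓞 ℚ)} (hv : (2 : 𝓞 ℚ) ∈ v.asIdeal)
    {g : Field.absoluteGaloisGroup (v.adicCompletion ℚ)}
    (hg : κ.IsTopGenerator (resGalOfEmb (closureEmb (K := ℚ) (v.adicCompletion ℚ)) g))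
    {c : ℕ → localPoints W (v.adicCompletion ℚ)}
    (hc : ∀ n, c n ∈ localLayerPointsOfEmb κ (closureEmb (K := ℚ) (v.adicCompletion ℚ)) W n)
    (hTr : ∀ n, 1 ≤ n → localTraceOfEmb κ (closureEmb (K := ℚ) (v.adicCompletion ℚ)) W n (n + 1)
      (c (n + 1)) = W.frobeniusTrace 2 • c n - c (n - 1))
    (hinj : ∀ z₀ : localLayerPointsOfEmb κ (closureEmb (K := ℚ) (v.adicCompletion ℚ)) W 0 →+ ℤ_[2],
      evalOn W (localLayerPointsOfEmb κ (closureEmb (K := ℚ) (v.adicCompletion ℚ)) W 0) z₀ (c 0) = 0 →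
        z₀ = 0)
    (hsat : ∀ a : ℤ_[2],
      (∃ z₀ : localLayerPointsOfEmb κ (closureEmb (K := ℚ) (v.adicCompletion ℚ)) W 0 →+ ℤ_[2],
        evalOn W (localLayerPointsOfEmb κ (closureEmb (K := ℚ) (v.adicCompletion ℚ)) W 0) z₀ (c 0) =
          2 * a) →
      ∃ y : localLayerPointsOfEmb κ (closureEmb (K := ℚ) (v.adicCompletion ℚ)) W 0 →+ ℤ_[2],
        evalOn W (localLayerPointsOfEmb κ (closureEmb (K := ℚ) (v.adicCompletion ℚ)) W 0) y (c 0) = a) :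
    Finite (W.selmerGroupPInfty 2) →
      Finite (EndCoinvariants (conjSharpFlatSelmerInfty W κ (closureEmb (K := ℚ) (v.adicCompletion ℚ))
        (W.frobeniusTrace 2) g c .flat γ - 1)) →
      Nat.card (↥((sharpFlatSelmerInfty W κ (closureEmb (K := ℚ) (v.adicCompletion ℚ))
            (W.frobeniusTrace 2) g c .flat).comap (W.layerToInfty κ 0)) ⧸
          (W.selmerLayer κ 0).addSubgroupOf
            ((sharpFlatSelmerInfty W κ (closureEmb (K := ℚ) (v.adicCompletion ℚ))
              (W.frobeniusTrace 2) g c .flat).comap (W.layerToInfty κ 0))) *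
        Nat.card (MulAction.fixedPoints (Field.absoluteGaloisGroup ℚ) (W.geomPrimaryTorsion 2)) =
      2 ^ (padicValNat 2 W.tamagawaProduct) *
        Nat.card (EndCoinvariants (conjSharpFlatSelmerInfty W κ
          (closureEmb (K := ℚ) (v.adicCompletion ℚ)) (W.frobeniusTrace 2) g c .flat γ - 1)) :=
  SSFlatEC.flatCountTwo_all W hss κ (LocalIwH1.isCyclotomic_of_rat κ) hγ hv hg hc hTr hinj hsat

/-- **COUNT♭@2 keyed on a Honda system at two** — the hypothesis prefix of the v2.16 registry's `FlatPackageAtTwo`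
(`hg`, `IsHondaSystemAtTwo κ ι W a₂ g cneg c`): the Honda₂ clauses `hc hTr` are fields of the Honda system and (INJ)/(SAT)
ON `c 0 = (a₂² − 2a₂ − 1) • cneg` transfer from `cneg` along the odd integer `a₂² − 2a₂ − 1` (`a₂ ∈ {0, ±2}` at a good
supersingular `2`; `SSFlatLocalData.inj_of_inj_zsmul` / `sat_of_sat_zsmul`, seat ss-1's p827135), then `flatCount_two`.
By-name form for dropping the COUNT♭ conjunct of `FlatPackageAtTwo`: `flatCount_two_of_isHondaSystemAtTwo W hss κ hγ hv hg hH`.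
[cite: Sprung2012, Thm. 2.2 and Lemma 7.9 (pp. 1487, 1503)] [cite: GreenbergLNM1716, §4 Lemma 4.7 (pp. 107–108)]
[cite: Sprung2024, §5.2 Lemma 5.5 (pp. 39–41)] -/
theorem flatCount_two_of_isHondaSystemAtTwo (W : WeierstrassCurve ℚ) [W.IsElliptic] [W.IsGloballyMinimal]
    (hss : GoodSS W 2) (κ : ZpExtension ℚ 2) {γ : Field.absoluteGaloisGroup ℚ} (hγ : κ.IsTopGenerator γ)
    {v : HeightOneSpectrum (𝓞 ℚ)} (hv : (2 : 𝓞 ℚ) ∈ v.asIdeal)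
    {g : Field.absoluteGaloisGroup (v.adicCompletion ℚ)}
    (hg : κ.IsTopGenerator (resGalOfEmb (closureEmb (K := ℚ) (v.adicCompletion ℚ)) g))
    {cneg : localPoints W (v.adicCompletion ℚ)} {c : ℕ → localPoints W (v.adicCompletion ℚ)}
    (hH : Summit.BirchSwinnertonDyer.Rank1Residual.F1Sign2.IsHondaSystemAtTwo κ
      (closureEmb (K := ℚ) (v.adicCompletion ℚ)) W (W.frobeniusTrace 2) g cneg c) :
    Finite (W.selmerGroupPInfty 2) →
      Finite (EndCoinvariants (conjSharpFlatSelmerInfty W κ (closureEmb (K := ℚ) (v.adicCompletion ℚ))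
        (W.frobeniusTrace 2) g c .flat γ - 1)) →
      Nat.card (↥((sharpFlatSelmerInfty W κ (closureEmb (K := ℚ) (v.adicCompletion ℚ))
            (W.frobeniusTrace 2) g c .flat).comap (W.layerToInfty κ 0)) ⧸
          (W.selmerLayer κ 0).addSubgroupOf
            ((sharpFlatSelmerInfty W κ (closureEmb (K := ℚ) (v.adicCompletion ℚ))
              (W.frobeniusTrace 2) g c .flat).comap (W.layerToInfty κ 0))) *
        Nat.card (MulAction.fixedPoints (Field.absoluteGaloisGroup ℚ) (W.geomPrimaryTorsion 2)) =
      2 ^ (padicValNat 2 W.tamagawaProduct) *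
        Nat.card (EndCoinvariants (conjSharpFlatSelmerInfty W κ
          (closureEmb (K := ℚ) (v.adicCompletion ℚ)) (W.frobeniusTrace 2) g c .flat γ - 1)) := by
  obtain ⟨hcneg, hc, hc0, -, hTr, hinj, hsat, -⟩ := hH
  have hodd : ¬ (2 : ℤ) ∣ W.frobeniusTrace 2 ^ 2 - 2 * W.frobeniusTrace 2 - 1 :=
    SSFlatLocalData.not_two_dvd_sq_sub _ (Supersingular.frobeniusTrace_two_eq_zero_or W hss.1 hss.2)
  exact flatCount_two W hss κ hγ hv hg hc hTr (SSFlatLocalData.inj_of_inj_zsmul W _ hcneg hodd hc0 hinj)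
    (SSFlatLocalData.sat_of_sat_zsmul W _ hcneg hodd hc0 hsat)

/-- **EC♭@2 with the COUNT DISCHARGED — the ♭ `Γ`-Euler characteristic at `2` for ONE curve and ONE local datum,
from the Honda₂ clauses alone.** For `W/ℚ` elliptic, globally minimal, good supersingular at `2`; a `ℤ₂`-extension `κ`
of `ℚ` with topological generator `γ`; the place `v ∋ 2`; a local `g` restricting to a generator;
local points `c` with the Honda₂ clauses: for every ♭ dual datum `D` with `X♭` finitely generated torsion, `char X♭ = (f)`
and `Sel_{2^∞}(E/ℚ)` finite — `f(0) = u · 2^{ord₂ ∏ c_ℓ} · #Sel_{2^∞}(E/ℚ)`, `u ∈ ℤ₂ˣ`.  This is `flatEulerChar_two` with its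
`hcount` binder fed by `flatCount_two`, i.e. with `hcount` DELETED and no binder added (Sprung 2024 Lemmas 5.5 · 5.8 · 5.9 and
Greenberg's Lemmas 4.2–4.7 at `p = 2`, all in the kernel). [cite: Sprung2024, §5.2 Lemmas 5.5, 5.8, 5.9 and Proof of Thm. 5.3 (pp. 40–41)]
[cite: Sprung2012, Lemma 2.3 and Thm. 2.2 (2′) (p. 1487), Prop. 7.3 (p. 1500)] [cite: GreenbergLNM1716, §4 Lemmas 4.2–4.7] -/
theorem flatEulerChar_two_of_honda (W : WeierstrassCurve ℚ) [W.IsElliptic] [W.IsGloballyMinimal]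
    (hss : GoodSS W 2) (κ : ZpExtension ℚ 2) {γ : Field.absoluteGaloisGroup ℚ}
    (hγ : κ.IsTopGenerator γ) {v : HeightOneSpectrum (𝓞 ℚ)} (hv : (2 : 𝓞 ℚ) ∈ v.asIdeal)
    {g : Field.absoluteGaloisGroup (v.adicCompletion ℚ)}
    (hg : κ.IsTopGenerator (resGalOfEmb (closureEmb (K := ℚ) (v.adicCompletion ℚ)) g))
    {c : ℕ → localPoints W (v.adicCompletion ℚ)}
    (hc : ∀ n, c n ∈ localLayerPointsOfEmb κ (closureEmb (K := ℚ) (v.adicCompletion ℚ)) W n)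
    (hTr : ∀ n, 1 ≤ n → localTraceOfEmb κ (closureEmb (K := ℚ) (v.adicCompletion ℚ)) W n (n + 1)
      (c (n + 1)) = W.frobeniusTrace 2 • c n - c (n - 1))
    (hinj : ∀ z₀ : localLayerPointsOfEmb κ (closureEmb (K := ℚ) (v.adicCompletion ℚ)) W 0 →+ ℤ_[2],
      evalOn W (localLayerPointsOfEmb κ (closureEmb (K := ℚ) (v.adicCompletion ℚ)) W 0) z₀ (c 0) = 0 →
        z₀ = 0)
    (hsat : ∀ a : ℤ_[2],
      (∃ z₀ : localLayerPointsOfEmb κ (closureEmb (K := ℚ) (v.adicCompletion ℚ)) W 0 →+ ℤ_[2],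
        evalOn W (localLayerPointsOfEmb κ (closureEmb (K := ℚ) (v.adicCompletion ℚ)) W 0) z₀ (c 0) =
          2 * a) →
      ∃ y : localLayerPointsOfEmb κ (closureEmb (K := ℚ) (v.adicCompletion ℚ)) W 0 →+ ℤ_[2],
        evalOn W (localLayerPointsOfEmb κ (closureEmb (K := ℚ) (v.adicCompletion ℚ)) W 0) y (c 0) = a)
    (D : SharpFlatSelmerDualData W κ γ (closureEmb (K := ℚ) (v.adicCompletion ℚ))
      (W.frobeniusTrace 2) g c .flat) [Module.Finite (IwasawaAlgebra 2) D.X]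
    (hX : Module.IsTorsion (IwasawaAlgebra 2) D.X) (f : IwasawaAlgebra 2) (hf : D.charIdeal = Ideal.span {f})
    (hfin : Finite (W.selmerGroupPInfty 2)) :
    ∃ u : ℤ_[2]ˣ, ((PowerSeries.constantCoeff f : ℤ_[2]) : ℚ_[2]) =
      ((u : ℤ_[2]) : ℚ_[2]) * ((2 : ℕ) : ℚ_[2]) ^ (padicValNat 2 W.tamagawaProduct) *
        (Nat.card (W.selmerGroupPInfty 2) : ℚ_[2]) :=
  flatEulerChar_two W hss κ hγ hv hg hc hTr hinj hsat (flatCount_two W hss κ hγ hv hg hc hTr hinj hsat)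
    D hX f hf hfin

end SSFlatRoad
end Summit.BirchSwinnertonDyer.BirchSwinnertonDyer.Theorems

end
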